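import Summits.BirchSwinnertonDyer.Rank1Residual.Partition.IrreducibleOverQuadraticField
import Summits.BirchSwinnertonDyer.Rank1Residual.Partition.AnticyclotomicControlJSWEmbAt
import Literature.NumberTheory.EllipticCurves.SupersingularIrreducibleProofs
import HarnessLib

/-!
# Good SUPERSINGULAR `p` (odd) ⟹ (irred_𝒦) over every quadratic field — the `hIrrK` binder of the
# supersingular rank-one class theorems (X6 ∧ r = 1, row C3 ∩ {ss}) is a THEOREM
# (cell `b2b-bsdres`, GLUE seat gen 7, ask A16 for X6; companion of `IrreducibleOverQuadraticField.lean`)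

HONEST FRAMING (cell `b2b-bsdres`, run/shared/lean/b2b/bsd-rank1-residual/, verbatim in every
file): the goal of the cell is to DELETE the COMBINATION-SHAPED residual classes of the
Birch–Swinnerton-Dyer formula for ALL analytic-rank `≤ 1` elliptic curves over `ℚ` — "full BSD
formula for every rank `≤ 1` curve in class `C`" assembled STRICTLY from published theorems — so
that the rank-`≤ 1` remainder becomes exactly the CONSTRUCTION-SHAPED classes, which are TYPED
(missing-input `Prop`s), NOT attempted. This is not "finishing BSD". Nothing below is a class
theorem by itself except the two re-keyed forms of §4 (whose typed anticyclotomic IMC binder `hLA`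
at a supersingular prime is OPEN in print — X6 ∩ {`r_an = 1`} stays CONSTRUCTION-SHAPED); no named
fact is introduced (THEOREMS ONLY, our own elementary work, hence `Summits/`).

## What this module proves

`IrreducibleOverQuadraticField.lean` (this gen) proved (sur) ⟹ (irred_𝒦) for a quadratic `K`, which
serves the rows that carry the bit (sur) (C2, C16, C3-ordinary). The supersingular class theorems —
lit-cw's `Supersingular.X6.bsdp_of_thm331_of_onTreeGoodIMC_of_sprung` and
`Supersingular.RowC3.bsdp_of_goodSS_of_thm331_of_sprung` (`AnticyclotomicControlJSWEmbAt.lean`) —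
carry (irred_𝒦) too (JSW 2017 Thm. 3.3.1's hypothesis), but X6 has no (sur) bit. Here (irred_𝒦) is
proved on the whole supersingular locus from Serre's Proposition 12 as it stands in the tree
(`isCyclic_and_card_inertia_map_of_dvd_frobeniusTrace`: at an odd prime `p ∤ Δ` with `p ∣ a_p` the
inertia group at the place's prime acts on `E[p]` through a CYCLIC group of order `p² − 1`):

* `hasIrreducibleModPGaloisRep_baseChange_of_forall_stable` (§1) — the transport step of
  `hasIrreducibleModPGaloisRep_baseChange_of_hasSurjectiveModNGaloisRep`, isolated: if every
  `res(Γ_L)`-stable subgroup of `E[p]` is `0` or `E[p]`, then `E_L[p]` is an irreducible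
  `Γ_L`-module (any field `F`, any algebraic `L/F`; the tree's equivariant
  `WeierstrassCurve.exists_addEquiv_geomPoints_baseChange`).
* `index_range_absGaloisRestrict_eq_two` (§2) — `[Γ_F : res(Γ_L)] = 2` for `[L : F] = 2`, char `0`.
* `hasIrreducibleModPGaloisRep_baseChange_of_dvd_frobeniusTrace` (§3) — for `E/ℚ` globally minimal,
  `p` odd with `p ∤ Δ_E` and `p ∣ a_p`, and ANY quadratic number field `K` (no splitting condition):
  `E[p]` is an irreducible `G_K`-module. Proof: a `res(Γ_K)`-stable line `Φ ≤ E[p]` is stable under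
  `τ²` for the generator `τ` of the cyclic inertia image (`τ² ∈ res(Γ_K)`, index `2`); `τ²` acts on
  `Φ` and on `E[p]/Φ` by scalars `k, d ∈ 𝔽_pˣ` (the tree's `exists_smul_eq_zsmul_of_stable`,
  `exists_smul_sub_zsmul_mem_of_stable`), so `(τ²)^{p−1}` is unipotent (Fermat) and `(τ²)^{(p−1)p}`
  is trivial on `E[p]` (`pow_prime_smul_eq_self_of_unipotent`): `p² − 1 ∣ 2p(p − 1)`, i.e.
  `p + 1 ∣ 2p`, absurd for every prime. (Serre 1972 §1.11 Prop. 12 gives irreducibility over `ℚ`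
  by the same argument with `τ` in place of `τ²`: the tree's
  `hasIrreducibleModPGaloisRep_of_dvd_frobeniusTrace`.)
* §4 the cell-level forms: `irrK_of_goodSS` (`p ≠ 2 → Good W p → p ∣ a_p → [K : ℚ] = 2 →
  (W.baseChange K).HasIrreducibleModPGaloisRep p`) and the two supersingular class theorems of
  `AnticyclotomicControlJSWEmbAt.lean` with `hIrrK` DISCHARGED:
  `Supersingular.X6.bsdp_of_thm331_of_onTreeGoodIMC_of_sprung_irrK`,
  `Supersingular.RowC3.bsdp_of_goodSS_of_thm331_of_sprung_irrK` (remaining typed input: `hLA`, the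
  anticyclotomic IMC ∘ BDP at the supersingular `p` — Castella–Wan Conj. 5.2; NOT in print).

References: J.-P. Serre, Invent. Math. 15 (1972) §1.11 Prop. 12; Jetchev–Skinner–Wan, Camb. J.
Math. 5 (2017) Thm. 3.3.1 (hypothesis (irred_𝒦)); the module docstrings of
`Literature/…/SupersingularIrreducibleProofs.lean` and `Partition/IrreducibleOverQuadraticField.lean`;
HOME/b2b-bsdres-lit-glue/GLUE.md GEN 7 ADDENDUM (A16).
-/

set_option autoImplicit false

noncomputable section

open scoped Classical NumberField Pointwise

open WeierstrassCurve Field IsDedekindDomain NumberField Rat.HeightOneSpectrum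
  Literature.NumberTheory.EllipticCurves Literature.NumberTheory.EllipticCurves.Rank1Residual
  Literature.NumberTheory.GaloisRepresentations Literature.NumberTheory.EllipticCurves.ModularForms
  Literature.NumberTheory.Automorphic Literature.NumberTheory.EllipticCurves.Rank1Residual.Typed
  Literature.NumberTheory.EllipticCurves.JetchevSkinnerWan2017

universe u

namespace Summit.BirchSwinnertonDyer.Rank1Residual

/-! ### §1 The transport step, isolated -/

section Transport

variable {F : Type u} [Field F] (W : WeierstrassCurve F) (L : Type u) [Field L] [Algebra F L]
  [Algebra.IsAlgebraic F L] (p : ℕ)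

/-- **Irreducibility over `L` from the absence of `res(Γ_L)`-stable lines over `F`.** If every
additive subgroup of `E[p] = E(F̄)[p]` stable under the image `res(Γ_L) ≤ Γ_F` of the restriction
map is `0` or `E[p]`, then `E_L[p] = E(L̄)[p]` is an irreducible `Γ_L`-module: a `Γ_L`-stable
subgroup of `E_L[p]` pulls back, along the `res`-equivariant identification `E(F̄) ≃ E_L(L̄)`
(`exists_addEquiv_geomPoints_baseChange`) restricted to `p`-torsion, to a `res(Γ_L)`-stable subgroup
of `E[p]`. [folklore] -/
theorem hasIrreducibleModPGaloisRep_baseChange_of_forall_stable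
    (hN : ∀ H₀ : AddSubgroup (geomTorsion W (p : ℤ)),
      (∀ σ ∈ (absGaloisRestrict F L).range, ∀ T ∈ H₀, σ • T ∈ H₀) → H₀ = ⊥ ∨ H₀ = ⊤) :
    (W.baseChange L).HasIrreducibleModPGaloisRep p := by
  obtain ⟨e, he⟩ := W.exists_addEquiv_geomPoints_baseChange L
  -- restriction of `e` to `p`-torsion, onto `E_L[p]`, equivariant along `res`
  have hmem : ∀ T : geomTorsion W (p : ℤ), e T ∈ geomTorsion (W.baseChange L) (p : ℤ) := by
    intro T
    rw [AddSubgroup.torsionBy.nsmul_iff, ← map_nsmul, AddSubgroup.torsionBy.nsmul_iff.mp T.2,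
      map_zero]
  let φ : geomTorsion W (p : ℤ) →+ geomTorsion (W.baseChange L) (p : ℤ) :=
    AddMonoidHom.codRestrict ((e : W.geomPoints →+ (W.baseChange L).geomPoints).comp
      (geomTorsion W (p : ℤ)).subtype) (geomTorsion (W.baseChange L) (p : ℤ)) hmem
  have hφ : ∀ T, ((φ T : geomTorsion (W.baseChange L) (p : ℤ)) : (W.baseChange L).geomPoints) = e T :=
    fun T ↦ rfl
  have hφsurj : Function.Surjective φ := by
    intro S
    have hS : e.symm S ∈ geomTorsion W (p : ℤ) := by
      rw [AddSubgroup.torsionBy.nsmul_iff]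
      apply e.injective
      rw [map_nsmul, AddEquiv.apply_symm_apply, map_zero]
      exact AddSubgroup.torsionBy.nsmul_iff.mp S.2
    refine ⟨⟨e.symm S, hS⟩, Subtype.ext ?_⟩
    rw [hφ]
    exact e.apply_symm_apply S
  have hφsmul : ∀ (γ : absoluteGaloisGroup L) (T : geomTorsion W (p : ℤ)),
      φ (absGaloisRestrict F L γ • T) = γ • φ T := fun γ T ↦
    Subtype.ext (by
      rw [AddSubgroup.torsionBy.coe_smul, hφ, hφ, AddSubgroup.torsionBy.coe_smul]
      exact he γ T)
  unfold WeierstrassCurve.HasIrreducibleModPGaloisRep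
  intro H hH
  set H₀ : AddSubgroup (geomTorsion W (p : ℤ)) := H.comap φ with hH₀def
  have hH₀ : ∀ σ ∈ (absGaloisRestrict F L).range, ∀ T ∈ H₀, σ • T ∈ H₀ := by
    rintro σ ⟨γ, rfl⟩ T hT
    rw [hH₀def, AddSubgroup.mem_comap] at hT ⊢
    have h := hH γ _ hT
    rw [← hφsmul γ T] at h
    exact h
  rcases hN H₀ hH₀ with h | h
  · left
    rw [eq_bot_iff]
    intro x hx
    obtain ⟨T, rfl⟩ := hφsurj x
    have hT : T ∈ H₀ := by rw [hH₀def, AddSubgroup.mem_comap]; exact hx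
    rw [h, AddSubgroup.mem_bot] at hT
    rw [hT, map_zero]
    exact AddSubgroup.zero_mem _
  · right
    rw [eq_top_iff]
    intro x _
    obtain ⟨T, rfl⟩ := hφsurj x
    have hT : T ∈ H₀ := by rw [h]; exact AddSubgroup.mem_top T
    rw [hH₀def, AddSubgroup.mem_comap] at hT
    exact hT

end Transport

/-! ### §2 `[Γ_F : res(Γ_L)] = 2` for a quadratic extension -/

section Index

variable (F : Type u) [Field F] [CharZero F] (L : Type u) [Field L] [Algebra F L]

/-- For `[L : F] = 2` (characteristic `0`) the image of the restriction `Γ_L → Γ_F` has index `2`: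
it is the kernel of `Γ_F ↠ Gal(L/F)` (`absGaloisQuot`), a group of order `[L : F]`. [folklore] -/
theorem index_range_absGaloisRestrict_eq_two (h2 : Module.finrank F L = 2) :
    (absGaloisRestrict F L).range.index = 2 := by
  haveI : Module.Finite F L := Module.finite_of_finrank_eq_succ h2
  haveI : Algebra.IsQuadraticExtension F L := ⟨h2⟩
  have hker : (absGaloisQuot F L).ker = (absGaloisRestrict F L).range := by
    ext τ
    rw [MonoidHom.mem_ker]
    exact absGaloisQuot_eq_one_iff F L τ
  rw [← hker, Subgroup.index_ker, MonoidHom.range_eq_top.2 (absGaloisQuot_surjective F L),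
    Subgroup.card_top, IsGalois.card_aut_eq_finrank, h2]

end Index

/-! ### §3 Supersingular ⟹ (irred_𝒦) for every quadratic `K` -/

section Supersingular

variable (W : WeierstrassCurve ℚ) [W.IsElliptic] [W.IsGloballyMinimal] (p : ℕ) [Fact p.Prime]

/-- **At an odd prime of good supersingular reduction `E[p]` is irreducible over EVERY quadratic
field.** For `E/ℚ` globally minimal, `p ≠ 2`, `p ∤ Δ_E`, `p ∣ a_p` and a number field `K` with
`[K : ℚ] = 2`: `(W.baseChange K).HasIrreducibleModPGaloisRep p`. A `res(Γ_K)`-stable line `Φ ≤ E[p]`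
would be stable under `τ²` for `τ ∈ I_𝔓` generating the cyclic inertia image of order `p² − 1`
(Serre 1972 Prop. 12, tree `isCyclic_and_card_inertia_map_of_dvd_frobeniusTrace`; `τ² ∈ res(Γ_K)` as
the index is `2`); `τ²` acts on `Φ` and `E[p]/Φ` by scalars, so `(τ²)^{(p−1)p} = 1` on `E[p]` and
`p² − 1 ∣ 2(p − 1)p` — absurd. No splitting condition on `p` in `K` is needed.
[cite: Serre1972, §1.11 Prop. 12] [cite: SilvermanAEC2009, Cor. III.6.4(b)] -/
theorem hasIrreducibleModPGaloisRep_baseChange_of_dvd_frobeniusTrace (hp2 : p ≠ 2)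
    (hΔ : ¬ (p : ℤ) ∣ minimalDiscriminantInt W) (hss : (p : ℤ) ∣ W.frobeniusTrace p)
    (K : Type) [Field K] [NumberField K] (h2 : Module.finrank ℚ K = 2) :
    (W.baseChange K).HasIrreducibleModPGaloisRep p := by
  have hp : p.Prime := Fact.out
  refine hasIrreducibleModPGaloisRep_baseChange_of_forall_stable W K p fun Φ hΦN ↦ ?_
  have hN : (absGaloisRestrict ℚ K).range.index = 2 := index_range_absGaloisRestrict_eq_two ℚ K h2
  -- `#E[p] = p²`; suppose `Φ` is a line (`#Φ = p`)
  have hE := Rank1Residual.natCard_geomTorsion W p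
  haveI : Finite (geomTorsion W (p : ℤ)) :=
    Nat.finite_of_card_ne_zero (by rw [hE]; exact pow_ne_zero 2 hp.ne_zero)
  rcases eq_or_ne Φ ⊥ with hb | hb
  · exact Or.inl hb
  rcases eq_or_ne Φ ⊤ with ht | ht
  · exact Or.inr ht
  exfalso
  have hΦ : Nat.card Φ = p := by
    have hdvd : Nat.card Φ ∣ p ^ 2 := hE ▸ Φ.card_addSubgroup_dvd_card
    obtain ⟨i, hi, hΦi⟩ := (Nat.dvd_prime_pow hp).mp hdvd
    interval_cases i
    · exact absurd (AddSubgroup.card_eq_one.mp (by simpa using hΦi)) hb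
    · simpa using hΦi
    · exact absurd ((AddSubgroup.card_eq_iff_eq_top Φ).mp (by rw [hΦi, hE])) ht
  -- the place, its prime, and a generator `τ` of the cyclic inertia image of order `p² − 1`
  set v : HeightOneSpectrum (𝓞 ℚ) := primesEquiv.symm ⟨p, hp⟩ with hvdef
  have hv : (primesEquiv v : ℕ) = p := by rw [hvdef, Equiv.apply_symm_apply]
  obtain ⟨𝔓, hmem, h𝔓⟩ := exists_ideal_placeOver p hv
  have hT : ∀ π ζ : AlgebraicClosure ℚ, π ^ (p ^ 2 - 1) = p → ζ ^ (p ^ 2 - 1) = 1 →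
      ∃ s ∈ 𝔓.inertia (absoluteGaloisGroup ℚ), s • π = ζ * π := fun π ζ hπ hζ ↦
    exists_mem_inertia_smul_eq_mul_of_pow_eq p
      (Nat.sub_pos_of_lt (Nat.one_lt_pow two_ne_zero hp.one_lt)) hv h𝔓 hπ hζ
  obtain ⟨hcyc, hcard⟩ := isCyclic_and_card_inertia_map_of_dvd_frobeniusTrace p hΔ hss hp2 hmem hT
  set G := (𝔓.inertia (absoluteGaloisGroup ℚ)).map (galoisRepTorsion W (p : ℤ)) with hGdef
  haveI := hcyc
  obtain ⟨g, hg⟩ := IsCyclic.exists_ofOrder_eq_natCard (α := G)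
  obtain ⟨τ, -, hτg⟩ := Subgroup.mem_map.mp g.2
  have hordτ : orderOf (galoisRepTorsion W (p : ℤ) τ) = p ^ 2 - 1 := by
    rw [hτg, Subgroup.orderOf_coe, hg, hcard]
  -- `σ = τ²` lies in `res(Γ_K)` (index two) and stabilises `Φ`
  set σ : absoluteGaloisGroup ℚ := τ * τ with hσdef
  have hσN : σ ∈ (absGaloisRestrict ℚ K).range :=
    (Subgroup.mul_mem_iff_of_index_two hN).mpr Iff.rfl
  have hstab : ∀ P ∈ Φ, σ • P ∈ Φ := hΦN _ hσN
  obtain ⟨k, hk⟩ := exists_smul_eq_zsmul_of_stable hΦ hstab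
  obtain ⟨d, hd⟩ := exists_smul_sub_zsmul_mem_of_stable hΦ hE hstab
  -- `k` and `d` are prime to `p`
  haveI : Finite Φ := Nat.finite_of_card_ne_zero (by rw [hΦ]; exact hp.ne_zero)
  have hnt : 1 < Nat.card Φ := by rw [hΦ]; exact hp.one_lt
  haveI : Nontrivial Φ := Finite.one_lt_card_iff_nontrivial.mp hnt
  obtain ⟨⟨P₀, hP₀⟩, hP₀0⟩ := exists_ne (0 : Φ)
  have hP₀0' : P₀ ≠ 0 := fun h ↦ hP₀0 (Subtype.ext h)
  have hptor : ∀ P : geomTorsion W (p : ℤ), ((p : ℕ) : ℤ) • P = 0 := fun P ↦ by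
    rw [← Subtype.coe_inj, AddSubgroupClass.coe_zsmul, ZeroMemClass.coe_zero]
    exact (Submodule.mem_torsionBy_iff _ _).mp P.2
  have hkp : ¬ (p : ℤ) ∣ k := by
    rintro ⟨c, rfl⟩
    have h := hk P₀ hP₀
    rw [mul_zsmul, hptor] at h
    exact hP₀0' ((smul_eq_zero_iff_eq σ).mp h)
  have hdp : ¬ (p : ℤ) ∣ d := by
    rintro ⟨c, rfl⟩
    have hall : ∀ P : geomTorsion W (p : ℤ), σ • P ∈ Φ := fun P ↦ by
      have h := hd P
      rwa [mul_zsmul, hptor, sub_zero] at h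
    have htop : Φ = ⊤ := by
      refine eq_top_iff.mpr fun P _ ↦ ?_
      have := hall (σ⁻¹ • P)
      rwa [smul_inv_smul] at this
    exact ht htop
  -- Fermat
  have hpi : Prime (p : ℤ) := Nat.prime_iff_prime_int.mp hp
  have hfermat : ∀ m : ℤ, ¬ (p : ℤ) ∣ m → ∀ P : geomTorsion W (p : ℤ), (m ^ (p - 1)) • P = P := by
    intro m hm P
    have h1 : m ^ (p - 1) ≡ 1 [ZMOD p] :=
      Int.ModEq.pow_card_sub_one_eq_one hp ((hpi.coprime_iff_not_dvd.mpr hm).symm)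
    obtain ⟨c, hc⟩ := (Int.modEq_iff_dvd.mp h1.symm)
    have h2' : m ^ (p - 1) = 1 + (p : ℤ) * c := by linarith
    rw [h2', add_smul, one_smul, mul_zsmul, hptor, add_zero]
  -- `(τ²)^{p-1}` is unipotent, so `(τ²)^{(p-1)p}` is trivial on `E[p]`
  have hfix : ∀ P ∈ Φ, (σ ^ (p - 1)) • P = P := fun P hP ↦ by
    rw [pow_smul_eq_pow_zsmul hk (p - 1) P hP, hfermat k hkp P]
  have hquot : ∀ P : geomTorsion W (p : ℤ), (σ ^ (p - 1)) • P - P ∈ Φ := fun P ↦ by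
    have h := pow_smul_sub_pow_zsmul_mem hstab hd (p - 1) P
    rwa [hfermat d hdp P] at h
  have htriv : ∀ P : geomTorsion W (p : ℤ), (σ ^ ((p - 1) * p)) • P = P := fun P ↦ by
    rw [pow_mul]; exact pow_prime_smul_eq_self_of_unipotent hfix hquot P
  have hone : galoisRepTorsion W (p : ℤ) (σ ^ ((p - 1) * p)) = 1 :=
    (galoisRepTorsion_eq_one_iff' W (p : ℤ) _).mpr htriv
  rw [hσdef, ← pow_two, ← pow_mul, map_pow] at hone
  have hdvd : p ^ 2 - 1 ∣ 2 * ((p - 1) * p) := hordτ ▸ orderOf_dvd_of_pow_eq_one hone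
  -- `p² − 1 ∣ 2p(p − 1)` is absurd for a prime `p`
  obtain ⟨q, hq⟩ := hdvd
  have h1p : 1 ≤ p := hp.one_lt.le
  have h1p2 : 1 ≤ p ^ 2 := Nat.one_le_pow 2 p hp.pos
  have hqZ : (2 : ℤ) * (((p : ℤ) - 1) * p) = ((p : ℤ) ^ 2 - 1) * q := by
    have h := congrArg (Nat.cast : ℕ → ℤ) hq
    push_cast [Nat.cast_sub h1p, Nat.cast_sub h1p2] at h
    exact h
  have hp2Z : (2 : ℤ) ≤ p := by exact_mod_cast hp.two_le
  have hsq : (0 : ℤ) ≤ (p : ℤ) ^ 2 - 1 := by nlinarith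
  have hpos : (0 : ℤ) < ((p : ℤ) - 1) * p := mul_pos (by linarith) (by linarith)
  have hpp : (0 : ℤ) ≤ ((p : ℤ) - 2) * p := mul_nonneg (by linarith) (by linarith)
  rcases Nat.lt_or_ge q 2 with hq2 | hq2
  · interval_cases q
    · simp only [Nat.cast_zero, mul_zero] at hqZ
      linarith
    · simp only [Nat.cast_one, mul_one] at hqZ
      nlinarith
  · have hq2Z : (2 : ℤ) ≤ q := by exact_mod_cast hq2
    nlinarith [mul_nonneg (sub_nonneg.mpr hq2Z) hsq]

/-! ### §4 The cell-level forms -/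

/-- **Good supersingular odd `p` ⟹ (irred_𝒦) for every quadratic number field `K`.** For `E/ℚ`
globally minimal with `p ≠ 2` good and `p ∣ a_p` (the census bits of rows X6/X7/X8 and of C3 ∩
{ss}), `E[p]` is an irreducible `G_K`-module for every `K` with `[K : ℚ] = 2` — hypothesis
(irred_𝒦) of Jetchev–Skinner–Wan 2017 Thm. 3.3.1 at the Heegner fields.
[cite: Serre1972, §1.11 Prop. 12] [cite: JetchevSkinnerWan2017, Thm. 3.3.1 (hypothesis (irred_𝒦))] -/
theorem irrK_of_goodSS (hp2 : p ≠ 2) (hgood : Good W p) (hss : (p : ℤ) ∣ W.frobeniusTrace p)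
    (K : Type) [Field K] [NumberField K] (h2 : Module.finrank ℚ K = 2) :
    (W.baseChange K).HasIrreducibleModPGaloisRep p :=
  hasIrreducibleModPGaloisRep_baseChange_of_dvd_frobeniusTrace W p hp2
    (W.not_dvd_minimalDiscriminantInt_of_hasGoodReductionAtPrime' p hgood) hss K h2

end Supersingular

/-! ### §5 The supersingular rank-one class theorems with `hIrrK` discharged -/

namespace Supersingular

open Literature.NumberTheory.EllipticCurves.Wuthrich2014

variable (W : WeierstrassCurve ℚ) [W.IsElliptic] [W.IsGloballyMinimal] (p : ℕ) [Fact p.Prime]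

/-- **`BSD(E,p)` on X6 ∧ {r_an = 1} ∧ {p ≥ 5} with control PUBLISHED and (irred_𝒦) a THEOREM** —
lit-cw's `X6.bsdp_of_thm331_of_onTreeGoodIMC_of_sprung` with `hIrrK` DISCHARGED by `irrK_of_goodSS`
(X6 is good supersingular at `p ≥ 5`). The only typed input left is `hLA` = (IMC≥∘BDP) at the
supersingular `p` on the constructed `X_ac` (Castella–Wan Conj. 5.2 ∘ Brooks; NOT in print — X6 ∩
{`r_an = 1`} stays CONSTRUCTION-SHAPED); the upper half is Sprung 2024 Cor. 1.3 (ii) (`hS`).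
[cite: JetchevSkinnerWan2017, Thm. 3.3.1 with §3.5 (3.5.d)] [cite: Sprung2024, Cor. 1.3 (p. 5), second sentence]
[cite: CastellaWan2023, Conj. 5.2, Thm. 5.3 (MS p. 23)] [cite: Serre1972, §1.11 Prop. 12] [cite: Miller2011LMS, Def. 1.1] -/
theorem X6.bsdp_of_thm331_of_onTreeGoodIMC_of_sprung_irrK
    (hGZ : ∀ (N : ℕ) [NeZero N] (W : WeierstrassCurve ℚ) (K : Type) [Field K] [NumberField K],
      gross_zagier N W K)
    (hKo : ∀ (N : ℕ) [NeZero N] (W : WeierstrassCurve ℚ) (K : Type) [Field K] [NumberField K],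
      kolyvagin N W K)
    (hWu : sha_dvd_analyticSha) (hS : Sprung2024.cor13_padicValRat_bsd_rank_one_le)
    (h331 : thm331_anticyclotomicControl)
    (hGZK : rank_eq_analyticRank_of_analyticRank_le_one) (hmod : hasEntireLFunction_rat)
    (hnf : exists_isNewformOf)
    (hFH : friedbergHoffstein_exists_heegnerField_split_twist_ne_zero)
    (hMaz : mazur_not_dvd_maninConstant_of_odd)
    (hX : ClassX6 W p) (hp5 : 5 ≤ p) (hr : W.analyticRank = 1)
    (hLA : ∀ (N : ℕ) [NeZero N] (K : Type) [Field K] [NumberField K]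
      (Dt : ModularParametrizationData W N) (H : HeegnerDatum N (NumberField.discr K)) (ι : K →+* ℂ)
      (P : (W.baseChange K).toAffine.Point),
      W.conductorNorm ℤ = N → IsImaginaryQuadratic K → NumberField.discr K < -4 →
      SatisfiesHeegnerHypothesis N K → SatisfiesHeegnerHypothesis p K →
      (W.quadraticTwist (NumberField.discr K : ℚ)).entireLFunction 1 ≠ 0 →
      WeierstrassCurve.Affine.Point.map ι.toRatAlgHom P = heegnerPointComplex Dt H →
      ¬ (p : ℤ) ∣ Dt.c → ¬ IsOfFinAddOrder P →
      ∀ (κ : ZpExtension K p), κ.IsAnticyclotomic →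
        ∀ (γ : Field.absoluteGaloisGroup K) [Fact (κ.IsTopGenerator γ)]
          (𝔭 : HeightOneSpectrum (𝓞 K)) (h𝔭 : ((p : ℕ) : 𝓞 K) ∈ 𝔭.asIdeal)
          (he : 𝔭.asIdeal.ramificationIdx (𝓞 ℚ) = 1) (hf : 𝔭.asIdeal.inertiaDeg (𝓞 ℚ) = 1),
          X11b.IMCLowerWaldspurgerOnTreeGoodAt p κ 𝔭 γ (X11b.embAt K p 𝔭 h𝔭 he hf) P) :
    BSDp W p :=
  X6.bsdp_of_thm331_of_onTreeGoodIMC_of_sprung W p hGZ hKo hWu hS h331 hGZK hmod hnf hFH hMaz hX hp5 hr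
    (fun K _ _ hK _ _ ↦ irrK_of_goodSS W p (by omega) hX.1.1 hX.1.2 K hK.1) hLA

/-- **Row C3 ∩ {supersingular, `p ≥ 5`} with control PUBLISHED and (irred_𝒦) a THEOREM** — lit-cw's
`RowC3.bsdp_of_goodSS_of_thm331_of_sprung` with `hIrrK` DISCHARGED (`irrK_of_goodSS`); remaining
typed input `hLA` at the supersingular `p` (NOT in print). [cite: JetchevSkinnerWan2017, Thm. 1.2.1, Thm. 3.3.1]
[cite: Sprung2024, Cor. 1.3 (p. 5), second sentence] [cite: Serre1972, §1.11 Prop. 12] -/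
theorem RowC3.bsdp_of_goodSS_of_thm331_of_sprung_irrK
    (hGZ : ∀ (N : ℕ) [NeZero N] (W : WeierstrassCurve ℚ) (K : Type) [Field K] [NumberField K],
      gross_zagier N W K)
    (hKo : ∀ (N : ℕ) [NeZero N] (W : WeierstrassCurve ℚ) (K : Type) [Field K] [NumberField K],
      kolyvagin N W K)
    (hWu : sha_dvd_analyticSha) (hS : Sprung2024.cor13_padicValRat_bsd_rank_one_le)
    (h331 : thm331_anticyclotomicControl)
    (hGZK : rank_eq_analyticRank_of_analyticRank_le_one) (hmod : hasEntireLFunction_rat)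
    (hnf : exists_isNewformOf)
    (hFH : friedbergHoffstein_exists_heegnerField_split_twist_ne_zero)
    (hMaz : mazur_not_dvd_maninConstant_of_odd)
    (h : RowC3 W p) (hss : GoodSS W p) (hp5 : 5 ≤ p)
    (hLA : ∀ (N : ℕ) [NeZero N] (K : Type) [Field K] [NumberField K]
      (Dt : ModularParametrizationData W N) (H : HeegnerDatum N (NumberField.discr K)) (ι : K →+* ℂ)
      (P : (W.baseChange K).toAffine.Point),
      W.conductorNorm ℤ = N → IsImaginaryQuadratic K → NumberField.discr K < -4 →
      SatisfiesHeegnerHypothesis N K → SatisfiesHeegnerHypothesis p K →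
      (W.quadraticTwist (NumberField.discr K : ℚ)).entireLFunction 1 ≠ 0 →
      WeierstrassCurve.Affine.Point.map ι.toRatAlgHom P = heegnerPointComplex Dt H →
      ¬ (p : ℤ) ∣ Dt.c → ¬ IsOfFinAddOrder P →
      ∀ (κ : ZpExtension K p), κ.IsAnticyclotomic →
        ∀ (γ : Field.absoluteGaloisGroup K) [Fact (κ.IsTopGenerator γ)]
          (𝔭 : HeightOneSpectrum (𝓞 K)) (h𝔭 : ((p : ℕ) : 𝓞 K) ∈ 𝔭.asIdeal)
          (he : 𝔭.asIdeal.ramificationIdx (𝓞 ℚ) = 1) (hf : 𝔭.asIdeal.inertiaDeg (𝓞 ℚ) = 1),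
          X11b.IMCLowerWaldspurgerOnTreeGoodAt p κ 𝔭 γ (X11b.embAt K p 𝔭 h𝔭 he hf) P) :
    BSDp W p :=
  RowC3.bsdp_of_goodSS_of_thm331_of_sprung W p hGZ hKo hWu hS h331 hGZK hmod hnf hFH hMaz h hss hp5
    (fun K _ _ hK _ _ ↦ irrK_of_goodSS W p (by omega) hss.1 hss.2 K hK.1) hLA

end Supersingular

end Summit.BirchSwinnertonDyer.Rank1Residual

end
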